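import Summits.QuantumFields.YangMills.Theorems.VirialFluxGapFixFieldRegularity
import Summits.QuantumFields.YangMills.Theorems.VirialFluxGapPeriodicSoftnessOfEulerFieldFix
import Summits.QuantumFields.YangMills.Theorems.VirialFluxGapRingDeficitUpperBound
import HarnessLib

/-!
# Route `VirialFluxGap` (YangMills): `PeriodicSoftness` from a SMOOTH FRAME FIELD on `X_fix` with two POINTWISE inequalities —
# the last-mile reduction (all measure theory and all `HasDerivAt` plumbing of «EulerFieldFix» discharged)

The consumer ✓`TreeGaugeTransfer.periodicSoftness_of_eulerFieldFix` (w2 g51) asks for an `L`-uniform Euler-type record «EulerFieldFix» on the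
tree-gauged host `X_fix`: curves, coefficients, derivative fields with `HasDerivAt` clauses, uniform bounds, measurability, an error term and two
inequalities.  With the unit frame curves of ✓`VirialFluxGapFixCurves` (fcl-p3 g40) and the regularity packages of ✓`VirialFluxGapFixFieldRegularity`
(`fixUnitCurve_field_package`) every clause except the error term and the two inequalities is AUTOMATIC for a field
`X = Σ_{(v,a)} c_{(v,a)}(ringCoord(embed x))·∂_{(v,a)}` with SMOOTH coefficient functions `c_{(v,a)}` of the matrix coordinates in w2 g51's standard frame
✓`fixFrameStd` (`ι = FixVar L × Fin 3`, `#ι = 18L⁴ + 3`).  Hence: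

★★★ `periodicSoftness_of_smoothFrameField` — `PeriodicSoftness` BY NAME follows from: constants `c₁ > 0`, `K ≥ 1`, `q ≥ 0`, `L₀`, and for every
`L ≥ L₀` smooth coefficients `c : FixVar L × Fin 3 → (coordinates → ℝ)`, an error term `E` on `X_fix` (measurable, `0 ≤ E ≤ K·L^q`, `E = 0` where
`F_fix < (K·L^q)⁻¹`), `0 ≤ ε ≤ 1/4` with `ε·L⁴ ≤ c₁/72`, and the two POINTWISE inequalities on `X_fix`
  (drive)       `2(1−ε)·F_fix(x) − E(x) ≤ Σ_{va} c_va(M_x) · frameGrad fixFrameStd M_x va`,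
  (divergence)  `Σ_{va} frameD (fixFrameStd va) (c va) M_x ≤ 18L⁴ − 2c₁`,        `M_x := ringCoord(embed x)`,
i.e. `X·∇F_fix ≥ 2(1−ε)F_fix − E` and `div X ≤ 18L⁴ − 2c₁` in fcl-p3's frame-derivative letters (✓`FrameHessian.frameD ∕ frameGrad`).
(`periodicSoftness_of_smoothFrameField_inline`; the embedding is written inline, as in the consumer).  ★★★ `periodicSoftness_of_smoothFrameField_cutoff` —
the same with the ERROR TERM BUILT IN (`E := 2(1−ε)F_fix·𝟙{F_fix ≥ (K·L^q)⁻¹}`, admissible by fcl-p3's ✓`RingDeficit.ringDeficit_le_poly : F₀ ≤ 120·L⁴` once `K ≥ 240`, `q ≥ 4`):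
it asks only `0 ≤ X·∇F_fix` everywhere, `2(1−ε)F_fix ≤ X·∇F_fix` on `{F_fix < (K·L^q)⁻¹}`, and `div X ≤ 18L⁴ − 2c₁`.

This is where the generic resolvent field (fcl-p3: `2·resolventCoeff`, ✓`generic_drive_lower` ∕ ✓`generic_divergence_upper` ∕ ✓`sum_frameD_resolventCoeff` ∕
✓`deficitStep_cutoff_term_nonpos`), the central charts (w3 ∕ LEAD: `X_z + X_⊥`, ✓`cone_euler_*`, ✓`blockZeroModeField_div_le`) and the patching plug in.

HONEST FRAMING: a REDUCTION (theorems only, 0 `def`, 0 `sorry`, standard axioms); no coefficient field is constructed and neither inequality is proved here;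
⟨stmt-QuantumFields-24141⟩ and ⟨22884⟩ stay OPEN; no stub ∕ crux ∕ rung ∕ summit is closed; the Yang–Mills mass gap is NOT proved; no summit is proved by a line.
Width seat `ym-line-sfw-p2-w2` g52 (cell ym-idea-1, free hands), `--supports stmt-QuantumFields-24141`.
References: [cite: Griffiths1964] (virial ∕ equipartition identities); [cite: SeilerLNP1982, §2] (tree gauge); [cite: arXiv220412737, §2 (2.4) (p. 10)].
-/

set_option autoImplicit false

noncomputable section

open scoped Matrix BigOperators ContDiff Topology
open MeasureTheory
open Literature.MathematicalPhysics.QuantumFieldTheory hiding SU2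
open Literature.MathematicalPhysics.QuantumLattice
open Literature.MathematicalPhysics.QuantumFieldTheory.SUNBakryEmery (expSU coe_expSU matTop)

namespace Summit.QuantumFields.YangMills.Theorems.VirialFluxGap.FixField

open Summit.QuantumFields.YangMills.Theorems.FemtoTransferGap
open Summit.QuantumFields.YangMills.Theorems.FemtoTransferGap.TT
open Summit.QuantumFields.YangMills.Theorems.VirialFluxGap.RingDeficit
open Summit.QuantumFields.YangMills.Theorems.VirialFluxGap.FrameDerivative
open Summit.QuantumFields.YangMills.Theorems.VirialFluxGap.FrameHessian
open Summit.QuantumFields.YangMills.Theorems.VirialFluxGap.FixFrame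
open Summit.QuantumFields.YangMills.Theorems.VirialFluxGap.TreeGaugeTransfer (periodicSoftness_of_eulerFieldFix)

variable {L : ℕ} [NeZero L]

open scoped Matrix.Norms.Frobenius


/-- ★★★ **`PeriodicSoftness` from a smooth frame field on `X_fix` satisfying two pointwise inequalities** (embedding inline, as in the consumer).
Given `c₁ > 0`, `K ≥ 1`, `q ≥ 0`, `L₀`, and for every `L ≥ L₀`: smooth coefficient functions `c_va` of the coordinates (`va : FixVar L × Fin 3`), an
error term `E` (measurable, `0 ≤ E ≤ K·L^q`, vanishing where `F_fix < (K·L^q)⁻¹`), `0 ≤ ε ≤ 1/4` with `εL⁴ ≤ c₁/72`, the DRIVE inequality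
`2(1−ε)F_fix(x) − E x ≤ Σ_va c_va(M_x)·frameGrad fixFrameStd M_x va` and the DIVERGENCE inequality `Σ_va frameD (fixFrameStd va) (c va) M_x ≤ 18L⁴ − 2c₁`
(`M_x = ringCoord (glue x.1 ∷ x.2.1, x.2.2)`), the deciding crux `VirialFluxGap.PeriodicSoftness` holds BY NAME (via ✓`periodicSoftness_of_eulerFieldFix`,
all regularity clauses supplied by ✓`fixUnitCurve_field_package`).  No field is constructed here. [cite: Griffiths1964] [cite: SeilerLNP1982, §2] -/
theorem periodicSoftness_of_smoothFrameField_inline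
    (h : ∃ c₁ : ℝ, 0 < c₁ ∧ ∃ K : ℝ, 1 ≤ K ∧ ∃ q : ℝ, 0 ≤ q ∧ ∃ L₀ : ℕ, ∀ (L : ℕ) [NeZero L], L₀ ≤ L →
      ∃ (c : FixVar L × Fin 3 → ((Fin (2 * L - 1 + 1) → Edge 3 L → Matrix (Fin 2) (Fin 2) ℂ) × (Site 3 L → Matrix (Fin 2) (Fin 2) ℂ)) → ℝ)
        (E : (OffIdx L → SU2) × ((Fin (2 * L - 1) → GaugeConfig 3 L SU2) × (Site 3 L → SU2)) → ℝ) (ε : ℝ),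
        (∀ va, ContDiff ℝ ∞ (c va)) ∧ Measurable E ∧ (∀ x, 0 ≤ E x) ∧ (∀ x, E x ≤ K * (L : ℝ) ^ q) ∧
        (∀ x : (OffIdx L → SU2) × ((Fin (2 * L - 1) → GaugeConfig 3 L SU2) × (Site 3 L → SU2)), ringDeficit L (fun _ => false)
          ((Fin.cons (glue x.1) x.2.1 : Fin (2 * L - 1 + 1) → GaugeConfig 3 L SU2), x.2.2) < (K * (L : ℝ) ^ q)⁻¹ → E x = 0) ∧
        0 ≤ ε ∧ ε ≤ 1 / 4 ∧ ε * (L : ℝ) ^ 4 ≤ c₁ / 72 ∧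
        (∀ x : (OffIdx L → SU2) × ((Fin (2 * L - 1) → GaugeConfig 3 L SU2) × (Site 3 L → SU2)), 2 * (1 - ε) * ringDeficit L (fun _ => false)
            ((Fin.cons (glue x.1) x.2.1 : Fin (2 * L - 1 + 1) → GaugeConfig 3 L SU2), x.2.2) - E x ≤
          ∑ va, c va (ringCoord L ((Fin.cons (glue x.1) x.2.1 : Fin (2 * L - 1 + 1) → GaugeConfig 3 L SU2), x.2.2)) *
            frameGrad (L := L) fixFrameStd (ringCoord L ((Fin.cons (glue x.1) x.2.1 : Fin (2 * L - 1 + 1) → GaugeConfig 3 L SU2), x.2.2)) va) ∧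
        (∀ x : (OffIdx L → SU2) × ((Fin (2 * L - 1) → GaugeConfig 3 L SU2) × (Site 3 L → SU2)), ∑ va, frameD (fixFrameStd va) (c va)
            (ringCoord L ((Fin.cons (glue x.1) x.2.1 : Fin (2 * L - 1 + 1) → GaugeConfig 3 L SU2), x.2.2)) ≤ 18 * (L : ℝ) ^ 4 - 2 * c₁)) :
    Summit.QuantumFields.YangMills.Theses.VirialFluxGap.PeriodicSoftness := by
  obtain ⟨c₁, hc₁, K, hK, q, hq, L₀, hfield⟩ := h
  refine periodicSoftness_of_eulerFieldFix ⟨c₁, hc₁, K, hK, q, hq, L₀, fun L _ hL => ?_⟩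
  obtain ⟨c, E, ε, hc, hEm, hE0, hEle, hEsupp, hε0, hε4, hεL, hdrive, hdiv⟩ := hfield L hL
  obtain ⟨hγ, hφm, B, hφb, hDφ, hDF, hDφb, hDFb, hDφm, hDFm⟩ := fixUnitCurve_field_package (L := L) hc
  -- reindex the frame by `Fin n`
  set e : Fin (Fintype.card (FixVar L × Fin 3)) ≃ FixVar L × Fin 3 := (Fintype.equivFin (FixVar L × Fin 3)).symm with he
  refine ⟨Fintype.card (FixVar L × Fin 3), fun j => fixUnitCurve (e j),
    fun j x => c (e j) (ringCoord L ((Fin.cons (glue x.1) x.2.1 : Fin (2 * L - 1 + 1) → GaugeConfig 3 L SU2), x.2.2)),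
    fun j t x => frameD (fixFrameStd (e j)) (c (e j)) (ringCoord L ((Fin.cons (glue (x * fixUnitCurve (e j) t).1)
      (x * fixUnitCurve (e j) t).2.1 : Fin (2 * L - 1 + 1) → GaugeConfig 3 L SU2), (x * fixUnitCurve (e j) t).2.2)),
    fun j t x => frameGrad (L := L) fixFrameStd (ringCoord L ((Fin.cons (glue (x * fixUnitCurve (e j) t).1)
      (x * fixUnitCurve (e j) t).2.1 : Fin (2 * L - 1 + 1) → GaugeConfig 3 L SU2), (x * fixUnitCurve (e j) t).2.2)) (e j),
    E, ε, 1, B, fun j => hγ (e j), fun j => hφm (e j), fun j x => hφb (e j) x, one_pos,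
    fun j x t _ => hDφ (e j) x t, fun j x t _ => hDF (e j) x t, fun j x t _ => hDφb (e j) x t, fun j x t _ => hDFb (e j) x t,
    fun j => hDφm (e j), fun j => hDFm (e j), hEm, hE0, hEle, hEsupp, hε0, hε4, hεL, fun x => ?_, fun x => ?_⟩
  · -- drive: the `Fin n`-sum at `t = 0` is the frame sum at the point
    have hsum : ∑ j, c (e j) (ringCoord L ((Fin.cons (glue x.1) x.2.1 : Fin (2 * L - 1 + 1) → GaugeConfig 3 L SU2), x.2.2)) *
        frameGrad (L := L) fixFrameStd (ringCoord L ((Fin.cons (glue (x * fixUnitCurve (e j) 0).1)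
          (x * fixUnitCurve (e j) 0).2.1 : Fin (2 * L - 1 + 1) → GaugeConfig 3 L SU2), (x * fixUnitCurve (e j) 0).2.2)) (e j) =
        ∑ va, c va (ringCoord L ((Fin.cons (glue x.1) x.2.1 : Fin (2 * L - 1 + 1) → GaugeConfig 3 L SU2), x.2.2)) *
          frameGrad (L := L) fixFrameStd (ringCoord L ((Fin.cons (glue x.1) x.2.1 : Fin (2 * L - 1 + 1) → GaugeConfig 3 L SU2), x.2.2)) va := by
      simp only [fixUnitCurve_zero, mul_one]
      exact Equiv.sum_comp e (fun va => c va (ringCoord L ((Fin.cons (glue x.1) x.2.1 : Fin (2 * L - 1 + 1) → GaugeConfig 3 L SU2), x.2.2)) *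
        frameGrad (L := L) fixFrameStd (ringCoord L ((Fin.cons (glue x.1) x.2.1 : Fin (2 * L - 1 + 1) → GaugeConfig 3 L SU2), x.2.2)) va)
    rw [hsum]
    exact hdrive x
  · -- divergence
    have hsum : ∑ j, frameD (fixFrameStd (e j)) (c (e j)) (ringCoord L ((Fin.cons (glue (x * fixUnitCurve (e j) 0).1)
          (x * fixUnitCurve (e j) 0).2.1 : Fin (2 * L - 1 + 1) → GaugeConfig 3 L SU2), (x * fixUnitCurve (e j) 0).2.2)) =
        ∑ va, frameD (fixFrameStd va) (c va)
          (ringCoord L ((Fin.cons (glue x.1) x.2.1 : Fin (2 * L - 1 + 1) → GaugeConfig 3 L SU2), x.2.2)) := by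
      simp only [fixUnitCurve_zero, mul_one]
      exact Equiv.sum_comp e (fun va => frameD (fixFrameStd va) (c va)
        (ringCoord L ((Fin.cons (glue x.1) x.2.1 : Fin (2 * L - 1 + 1) → GaugeConfig 3 L SU2), x.2.2)))
    rw [hsum]
    exact hdiv x

/-- ★★★ **`PeriodicSoftness` from a smooth frame field on `X_fix` — CUT-OFF VERSION WITH THE ERROR TERM BUILT IN.**  Given `c₁ > 0`, `K ≥ 240`,
`q ≥ 4`, `L₀`, and for every `L ≥ L₀` smooth coefficients `c_va` and `0 ≤ ε ≤ 1/4` with `εL⁴ ≤ c₁/72` such that, with `M_x = ringCoord (glue x.1 ∷ x.2.1, x.2.2)`,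
(positivity) `0 ≤ Σ_va c_va(M_x)·frameGrad fixFrameStd M_x va` EVERYWHERE, (drive) `2(1−ε)F_fix(x) ≤ Σ_va c_va(M_x)·frameGrad fixFrameStd M_x va` on
`{F_fix < (K·L^q)⁻¹}`, and (divergence) `Σ_va frameD (fixFrameStd va) (c va) M_x ≤ 18L⁴ − 2c₁` everywhere, the crux `VirialFluxGap.PeriodicSoftness` holds
BY NAME — the error term `E := 2(1−ε)F_fix·𝟙{F_fix ≥ (K·L^q)⁻¹} ≤ 240L⁴ ≤ K·L^q` (✓`RingDeficit.ringDeficit_le_poly`) is supplied here. [cite: Griffiths1964] [cite: SeilerLNP1982, §2] -/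
theorem periodicSoftness_of_smoothFrameField_cutoff
    (h : ∃ c₁ : ℝ, 0 < c₁ ∧ ∃ K : ℝ, 240 ≤ K ∧ ∃ q : ℝ, 4 ≤ q ∧ ∃ L₀ : ℕ, ∀ (L : ℕ) [NeZero L], L₀ ≤ L →
      ∃ (c : FixVar L × Fin 3 → ((Fin (2 * L - 1 + 1) → Edge 3 L → Matrix (Fin 2) (Fin 2) ℂ) × (Site 3 L → Matrix (Fin 2) (Fin 2) ℂ)) → ℝ) (ε : ℝ),
        (∀ va, ContDiff ℝ ∞ (c va)) ∧ 0 ≤ ε ∧ ε ≤ 1 / 4 ∧ ε * (L : ℝ) ^ 4 ≤ c₁ / 72 ∧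
        (∀ x : (OffIdx L → SU2) × ((Fin (2 * L - 1) → GaugeConfig 3 L SU2) × (Site 3 L → SU2)), 0 ≤ ∑ va, c va (ringCoord L ((Fin.cons (glue x.1) x.2.1 : Fin (2 * L - 1 + 1) → GaugeConfig 3 L SU2), x.2.2)) * frameGrad (L := L) fixFrameStd (ringCoord L ((Fin.cons (glue x.1) x.2.1 : Fin (2 * L - 1 + 1) → GaugeConfig 3 L SU2), x.2.2)) va) ∧
        (∀ x : (OffIdx L → SU2) × ((Fin (2 * L - 1) → GaugeConfig 3 L SU2) × (Site 3 L → SU2)), ringDeficit L (fun _ => false) ((Fin.cons (glue x.1) x.2.1 : Fin (2 * L - 1 + 1) → GaugeConfig 3 L SU2), x.2.2) < (K * (L : ℝ) ^ q)⁻¹ →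
          2 * (1 - ε) * ringDeficit L (fun _ => false) ((Fin.cons (glue x.1) x.2.1 : Fin (2 * L - 1 + 1) → GaugeConfig 3 L SU2), x.2.2) ≤
            ∑ va, c va (ringCoord L ((Fin.cons (glue x.1) x.2.1 : Fin (2 * L - 1 + 1) → GaugeConfig 3 L SU2), x.2.2)) * frameGrad (L := L) fixFrameStd (ringCoord L ((Fin.cons (glue x.1) x.2.1 : Fin (2 * L - 1 + 1) → GaugeConfig 3 L SU2), x.2.2)) va) ∧
        (∀ x : (OffIdx L → SU2) × ((Fin (2 * L - 1) → GaugeConfig 3 L SU2) × (Site 3 L → SU2)), ∑ va, frameD (fixFrameStd va) (c va) (ringCoord L ((Fin.cons (glue x.1) x.2.1 : Fin (2 * L - 1 + 1) → GaugeConfig 3 L SU2), x.2.2)) ≤ 18 * (L : ℝ) ^ 4 - 2 * c₁)) :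
    Summit.QuantumFields.YangMills.Theses.VirialFluxGap.PeriodicSoftness := by
  obtain ⟨c₁, hc₁, K, hK, q, hq, L₀, hfield⟩ := h
  refine periodicSoftness_of_smoothFrameField_inline ⟨c₁, hc₁, K, by linarith, q, by linarith, L₀, fun L _ hL => ?_⟩
  obtain ⟨c, ε, hc, hε0, hε4, hεL, hpos, hdrive, hdiv⟩ := hfield L hL
  have hL1 : (1 : ℝ) ≤ L := by exact_mod_cast NeZero.one_le
  have hT : 240 * (L : ℝ) ^ 4 ≤ K * (L : ℝ) ^ q := by
    have h4 : (L : ℝ) ^ 4 ≤ (L : ℝ) ^ q := by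
      rw [show ((L : ℝ) ^ 4 : ℝ) = (L : ℝ) ^ ((4 : ℕ) : ℝ) from (Real.rpow_natCast _ 4).symm]
      exact Real.rpow_le_rpow_of_exponent_le hL1 (by norm_num; linarith)
    have hL4 : (0 : ℝ) ≤ (L : ℝ) ^ 4 := by positivity
    nlinarith
  have hFm := TreeGaugeTransfer.measurable_fixDeficit (L := L)
  refine ⟨c, fun x => if ringDeficit L (fun _ => false) ((Fin.cons (glue x.1) x.2.1 : Fin (2 * L - 1 + 1) → GaugeConfig 3 L SU2), x.2.2) < (K * (L : ℝ) ^ q)⁻¹ then 0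
      else 2 * (1 - ε) * ringDeficit L (fun _ => false) ((Fin.cons (glue x.1) x.2.1 : Fin (2 * L - 1 + 1) → GaugeConfig 3 L SU2), x.2.2), ε, hc, ?_, fun x => ?_, fun x => ?_, fun x hx => ?_,
    hε0, hε4, hεL, fun x => ?_, hdiv⟩
  · exact Measurable.ite (measurableSet_lt hFm measurable_const) measurable_const (hFm.const_mul _)
  · dsimp only
    split_ifs
    · exact le_rfl
    · exact mul_nonneg (by linarith) (ringDeficit_nonneg _ _)
  · dsimp only
    split_ifs
    · have : (0 : ℝ) ≤ (L : ℝ) ^ q := Real.rpow_nonneg (by positivity) q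
      nlinarith
    · have hF := RingDeficit.ringDeficit_le_poly (L := L) (fun _ => false) ((Fin.cons (glue x.1) x.2.1 : Fin (2 * L - 1 + 1) → GaugeConfig 3 L SU2), x.2.2)
      have hF0 := ringDeficit_nonneg (L := L) (fun _ => false) ((Fin.cons (glue x.1) x.2.1 : Fin (2 * L - 1 + 1) → GaugeConfig 3 L SU2), x.2.2)
      nlinarith
  · dsimp only
    rw [if_pos hx]
  · dsimp only
    split_ifs with hx
    · rw [sub_zero]
      exact hdrive x hx
    · rw [sub_self]
      exact hpos x

end Summit.QuantumFields.YangMills.Theorems.VirialFluxGap.FixField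

end
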